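import Mathlib.RingTheory.Invariant.Galois
import Literature.AlgebraicGeometry.Resolution.ValuationConjugation
import Literature.AlgebraicGeometry.Resolution.ValuationRingsApproximation
import Literature.AlgebraicGeometry.Resolution.SplittingRingUnramified
import HarnessLib

/-!
# Galois approximation, splitting part ([CoP1] Prop. 6.2 (1); Cossart–Piltant 2019, Prop. 4.13 (1)): large normal models have the valuation's decomposition group

Topic: `Literature/AlgebraicGeometry/Resolution`. PROOF side of `CossartPiltant2019ReductionP`
(`ArithmeticalThreefoldsLocal.lean`), input (C4), DECOMPOSITION layer of [CoP1] Prop. 9.3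
(hypothesis `hDec` of `cossartPiltant2019ReductionP_of_cjs_of_stableInertiaHensel`). The
printed proof of Prop. 9.3 starts (HAL p. 27) from

> (44) By proposition 6.2, there exists a normal local model `R₀` of `V/k` such that for any
> normal local model `R` of `V/k` dominating `R₀`, we have `Gˢ(W/V) = Gˢ(R̃/R)` …

and Prop. 6.2 (1) (Galois approximation, HAL p. 18; Cossart–Piltant 2019 Prop. 4.13 (1)) is
proved by: "Since the extensions of `V` to `L` are the localizations of `V̄` at its maximal
ideals `m₁, …, m_s`, any `R₀` such that for `1 ≤ i ≤ s`, the `m(Wᵢ) ∩ R̄₀`'s are pairwise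
distinct satisfies the statement about splitting groups". We prove the splitting-group
statement in Mathlib's AKLB frame (`A` integrally closed with fraction field `K`, `L | K`
finite Galois, `B` the integral closure of `A` in `L`, `Gal(L/K)` acting on `B` by
`IsIntegralClosure.MulSemiringAction` and on the valuation subrings of `L` pointwise):

* `exists_mem_forall_smul_valuation_eq_one` — PROVED: for a valuation ring `W` of `L` there
  is ONE element `a ∈ ⋂_τ τ • W` with `a ∈ 𝔪_W` and `a` a unit of every conjugate
  `σ • W ≠ W` (weak approximation for the pairwise incomparable conjugates,
  `ValuationSubring.exists_crt_of_forall_le_imp_eq`);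
* `smul_eq_of_valuation_smul_lt_one` — PROVED: for such `a`, `|σ a|_W < 1` forces `σ • W = W`;
* `exists_monic_aeval_eq_zero_coeff_mem` — PROVED: such an `a` is a root of a monic `p ∈ K[X]`
  all of whose coefficients lie in `W` (the characteristic polynomial `∏_σ (X − σ a)`, which is
  `Gal(L/K)`-invariant) — the finite set "`R₀ ∋` the coefficients of `p`";
* `stabilizer_le_stabilizer_of_mem` — PROVED: if `a ∈ B` then the stabilizer in `Gal(L/K)` of
  the centre `Q = 𝔪_W ∩ B` is contained in (hence equals) the decomposition group
  `{σ | σ • W = W}` ("`Gˢ(R̃/R) = Gˢ(W/V)`");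
* `stabilizer_le_stabilizer_of_coeff_mem_range` — PROVED, **[CoP1] Prop. 6.2 (1), splitting
  part**: as soon as the coefficients of `p` lie in `A`, `Gˢ(R̃/R) ≤ Gˢ(W/V)`;
* `surjective_quotient_maximalIdeal_pow_of_coeff_mem_range` — PROVED, **the density step of
  [CoP1] Prop. 9.3** assembled with `SplittingRingUnramified.lean`: for `A` moreover LOCAL and
  centred by `W`, and `H ≤ Gal(L/K)` any subgroup containing the decomposition group of `W`
  (i.e. `L^H ⊆ Kˢ`), `A → (B^H)_{𝔪_W ∩ B^H} / 𝔪^n` is onto for every `n` ("`R₁` lies dense in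
  `R₁′`").

Everything is PROVED; no named facts, definitions, instances or notation are introduced.

## Sources

* V. Cossart, O. Piltant, J. Algebra 320 (2008) 1051–1082: Prop. 6.2 (1) and its proof (HAL
  hal-00139124, p. 18), proof of Prop. 9.3 ((44), p. 27; p. 28). [CossartPiltant2008]
* V. Cossart, O. Piltant, J. Algebra 529 (2019) = arXiv:1412.0868, Prop. 4.13 (1) (arXiv v1:
  Prop. 4.9 (1), p. 54). [CossartPiltant2019]
* S. S. Abhyankar, Ann. of Math. Studies 43 (1959), Prop. 1.46, Thm. 1.47. [Abhyankar1959]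
-/

noncomputable section

open scoped Pointwise

open Polynomial

namespace Literature.AlgebraicGeometry.Resolution

universe u

/-! ## Field level: one element separating `W` from its conjugates -/

section FieldLevel

variable (K : Type*) {L : Type u} [Field K] [Field L] [Algebra K L] [FiniteDimensional K L]
  (W : ValuationSubring L)

/-- **Weak approximation among the conjugates of `W`**: there is `a ∈ L` lying in every
conjugate `τ • W`, in the maximal ideal of `W`, and a unit of every conjugate `σ • W ≠ W`
(the conjugates are pairwise incomparable, `ValuationSubring.eq_of_le_of_comap_eq`; weak
approximation `ValuationSubring.exists_crt_of_forall_le_imp_eq` gives `e ≡ 1 mod 𝔪_W`,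
`e ∈ 𝔪_{σ • W}`; take `a = 1 − e`). [cite: CossartPiltant2008, proof of Prop. 6.2 (1) (HAL p. 18)] -/
theorem exists_mem_forall_smul_valuation_eq_one :
    ∃ a : L, (∀ τ : L ≃ₐ[K] L, a ∈ τ • W) ∧ W.valuation a < 1 ∧
      ∀ σ : L ≃ₐ[K] L, σ • W ≠ W → (σ • W).valuation a = 1 := by
  classical
  haveI : Algebra.IsAlgebraic K L := Algebra.IsAlgebraic.of_finite K L
  set S : Finset (ValuationSubring L) := Finset.univ.image fun σ : L ≃ₐ[K] L => σ • W with hS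
  have hWS : W ∈ S := Finset.mem_image.mpr ⟨1, Finset.mem_univ _, one_smul _ _⟩
  have hR : ∀ i j : S, (i : ValuationSubring L) ≤ j → i = j := by
    intro i j hij
    apply Subtype.ext
    obtain ⟨σ, -, hσ⟩ := Finset.mem_image.mp i.2
    obtain ⟨τ, -, hτ⟩ := Finset.mem_image.mp j.2
    refine ValuationSubring.eq_of_le_of_comap_eq (F := K) hij ?_
    rw [← hσ, ← hτ, comap_smul_algEquiv, comap_smul_algEquiv]
  obtain ⟨e, hemem, he1, he2⟩ :=
    ValuationSubring.exists_crt_of_forall_le_imp_eq (fun i : S => (i : ValuationSubring L)) hR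
      ⟨W, hWS⟩
  refine ⟨1 - e, fun τ => ?_, ?_, fun σ hσ => ?_⟩
  · have hmem : τ • W ∈ S := Finset.mem_image.mpr ⟨τ, Finset.mem_univ _, rfl⟩
    exact (τ • W).sub_mem (τ • W).one_mem (hemem ⟨τ • W, hmem⟩)
  · rw [← Valuation.map_neg, neg_sub]
    exact he1
  · have hmem : σ • W ∈ S := Finset.mem_image.mpr ⟨σ, Finset.mem_univ _, rfl⟩
    have hne : (⟨σ • W, hmem⟩ : S) ≠ ⟨W, hWS⟩ := fun h => hσ (congrArg Subtype.val h)
    exact Valuation.map_one_sub_of_lt _ (he2 ⟨σ • W, hmem⟩ hne)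

omit [FiniteDimensional K L] in
/-- For `a` a unit of every conjugate `σ • W ≠ W`: if `|σ a|_W < 1` then `σ • W = W`
(`|σ a|_W < 1 ⟺ |a|_{σ⁻¹ • W} < 1`). [cite: CossartPiltant2008, proof of Prop. 6.2 (1) (HAL p. 18)] -/
theorem smul_eq_of_valuation_smul_lt_one {a : L}
    (ha : ∀ σ : L ≃ₐ[K] L, σ • W ≠ W → (σ • W).valuation a = 1) (σ : L ≃ₐ[K] L)
    (hσ : W.valuation (σ • a) < 1) : σ • W = W := by
  by_contra hne
  have hne' : σ⁻¹ • W ≠ W := fun h => hne (by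
    have := congrArg (fun A => σ • A) h
    simpa only [smul_inv_smul] using this.symm)
  have h1 : (σ⁻¹ • W).valuation a < 1 := by
    rw [valuation_smul_lt_one_iff, inv_inv]
    exact hσ
  rw [ha σ⁻¹ hne'] at h1
  exact lt_irrefl _ h1

/-- The element of `exists_mem_forall_smul_valuation_eq_one` is a root of a MONIC polynomial
over `K` all of whose coefficients lie in `W` — its characteristic polynomial
`∏_{σ ∈ Gal(L/K)} (X − σ a)`, whose coefficients are `Gal(L/K)`-invariant (hence in `K`,
`L | K` being Galois) and are polynomials in the conjugates `σ a ∈ W`. In [CoP1]: "`R₀` such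
that … `∈ R̄₀`" — the finitely many elements a normal local model must contain.
[cite: CossartPiltant2008, proof of Prop. 6.2 (1) (HAL p. 18)] -/
theorem exists_monic_aeval_eq_zero_coeff_mem [IsGalois K L] :
    ∃ (a : L) (p : K[X]), p.Monic ∧ aeval a p = 0 ∧ (∀ i, algebraMap K L (p.coeff i) ∈ W) ∧
      W.valuation a < 1 ∧ ∀ σ : L ≃ₐ[K] L, σ • W ≠ W → (σ • W).valuation a = 1 := by
  classical
  obtain ⟨a, haτ, ha1, haσ⟩ := exists_mem_forall_smul_valuation_eq_one K W
  -- the characteristic polynomial of `a` under `Gal(L/K)`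
  set G := L ≃ₐ[K] L
  have hfix : ∀ x : L, (∀ g : G, g • x = x) → ∃ k : K, algebraMap K L k = x := fun x hx =>
    (IsGalois.mem_range_algebraMap_iff_fixed x).mpr hx
  haveI : Algebra.IsInvariant K L G := ⟨hfix⟩
  obtain ⟨p, hp1, -, hp2⟩ := Polynomial.lifts_and_natDegree_eq_and_monic
    (Algebra.IsInvariant.charpoly_mem_lifts K L G a) (MulSemiringAction.monic_charpoly G a)
  refine ⟨a, p, hp2, ?_, fun i => ?_, ha1, haσ⟩
  · rw [aeval_def, eval₂_eq_eval_map, hp1, MulSemiringAction.eval_charpoly]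
  · have hcoeff : algebraMap K L (p.coeff i) = (MulSemiringAction.charpoly G a).coeff i := by
      rw [← hp1, coeff_map]
    rw [hcoeff]
    -- the characteristic polynomial has coefficients in `W`: it lifts to `W[X]`
    have hlift : MulSemiringAction.charpoly G a ∈ Polynomial.lifts (algebraMap W L) := by
      rw [MulSemiringAction.charpoly_eq]
      refine Subsemiring.prod_mem _ (fun g _ => ?_)
      have hga : g • a ∈ W := by
        have := haτ g⁻¹
        rwa [ValuationSubring.mem_pointwise_smul_iff_inv_smul_mem, inv_inv] at this
      refine (Polynomial.mem_lifts _).mpr ⟨X - C (⟨g • a, hga⟩ : W), ?_⟩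
      rw [Polynomial.map_sub, map_X, map_C]
      rfl
    obtain ⟨w, hw⟩ := (Polynomial.lifts_iff_coeff_lifts _).mp hlift i
    rw [← hw]
    exact w.2

end FieldLevel

/-! ## Model level: the AKLB frame -/

section Models

variable (A K : Type*) (L : Type u) (B : Type*) [CommRing A] [CommRing B] [Field K] [Field L]
  [Algebra A K] [Algebra B L] [IsFractionRing A K] [IsFractionRing B L]
  [Algebra A B] [Algebra K L] [Algebra A L] [IsScalarTower A K L] [IsScalarTower A B L]
  [IsIntegrallyClosed A] [IsIntegralClosure B A L] [FiniteDimensional K L]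
  (W : ValuationSubring L) (Q : Ideal B)

omit [IsFractionRing B L] [IsIntegrallyClosed A] in
/-- **"`Gˢ(R̃/R) = Gˢ(W/V)`" once `R̃ ∋ a`**: in the AKLB frame (`B` the integral closure of the
normal domain `A` in `L`, `Gal(L/K)` acting on `B`), if `B` contains an element `a ∈ 𝔪_W` that
is a unit of every conjugate `σ • W ≠ W`, then every `σ` stabilizing the centre
`Q = 𝔪_W ∩ B` of `W` on `B` stabilizes `W`. (The reverse inclusion is automatic.)
[cite: CossartPiltant2008, Prop. 6.2 (1) (HAL p. 18)] [cite: CossartPiltant2019, Prop. 4.13 (1)] -/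
theorem stabilizer_le_stabilizer_of_mem
    (hQ : ∀ b : B, b ∈ Q ↔ W.valuation (algebraMap B L b) < 1) {a : L}
    (ha : ∀ σ : L ≃ₐ[K] L, σ • W ≠ W → (σ • W).valuation a = 1) (ha1 : W.valuation a < 1)
    (b₀ : B) (hb₀ : algebraMap B L b₀ = a) :
    letI := IsIntegralClosure.MulSemiringAction A K L B
    MulAction.stabilizer (L ≃ₐ[K] L) Q ≤ MulAction.stabilizer (L ≃ₐ[K] L) W := by
  letI := IsIntegralClosure.MulSemiringAction A K L B
  haveI : Algebra.IsAlgebraic K L := Algebra.IsAlgebraic.of_finite K L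
  intro σ hσ
  rw [MulAction.mem_stabilizer_iff] at hσ ⊢
  apply smul_eq_of_valuation_smul_lt_one K W ha σ
  have hb₀Q : b₀ ∈ Q := (hQ b₀).mpr (by rw [hb₀]; exact ha1)
  have h1 : σ • b₀ ∈ Q := by
    rw [← hσ]
    exact Ideal.smul_mem_pointwise_smul_iff.mpr hb₀Q
  have h2 := (hQ _).mp h1
  have h3 : algebraMap B L (σ • b₀) = σ (algebraMap B L b₀) := algebraMap_galRestrict_apply A σ b₀
  rw [h3, hb₀] at h2
  exact h2

omit [IsFractionRing A K] [IsFractionRing B L] [Algebra A B] [IsScalarTower A B L]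
  [IsIntegrallyClosed A] [FiniteDimensional K L] in
/-- An element of `L` that is a root of a monic polynomial over `K` whose coefficients lie in
`A` is integral over `A`, hence lies in the integral closure `B`. [cite: CossartPiltant2008, proof of Prop. 6.2 (1) (HAL p. 18) ("`t₁, …, t_f ∈ R̃₀`")] -/
theorem exists_algebraMap_eq_of_coeff_mem_range {a : L} {p : K[X]} (hp : p.Monic)
    (hpa : aeval a p = 0) (hcoeff : ∀ i, p.coeff i ∈ (algebraMap A K).range) :
    ∃ b₀ : B, algebraMap B L b₀ = a := by
  have hl : p ∈ Polynomial.lifts (algebraMap A K) :=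
    (Polynomial.lifts_iff_coeff_lifts _).mpr (fun i => hcoeff i)
  obtain ⟨q, hq1, -, hq2⟩ := Polynomial.lifts_and_natDegree_eq_and_monic hl hp
  have hint : IsIntegral A a := by
    refine ⟨q, hq2, ?_⟩
    rw [← aeval_def, ← Polynomial.aeval_map_algebraMap K, hq1, hpa]
  exact (IsIntegralClosure.isIntegral_iff (A := B)).mp hint

omit [IsFractionRing B L] [IsIntegrallyClosed A] in
/-- **[CoP1] Prop. 6.2 (1), splitting part (Cossart–Piltant 2019, Prop. 4.13 (1)): every
normal local model containing the coefficients of `p` has `Gˢ(R̃/R) ≤ Gˢ(W/V)`.** With `a, p`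
from `exists_monic_aeval_eq_zero_coeff_mem`: if the coefficients of `p` lie in `A`, the
stabilizer of the centre `Q = 𝔪_W ∩ B` is contained in the decomposition group of `W`.
[cite: CossartPiltant2008, Prop. 6.2 (1) (HAL p. 18)] [cite: CossartPiltant2019, Prop. 4.13 (1) (arXiv v1: Prop. 4.9)] -/
theorem stabilizer_le_stabilizer_of_coeff_mem_range
    (hQ : ∀ b : B, b ∈ Q ↔ W.valuation (algebraMap B L b) < 1) {a : L} {p : K[X]} (hp : p.Monic)
    (hpa : aeval a p = 0) (hcoeff : ∀ i, p.coeff i ∈ (algebraMap A K).range)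
    (ha1 : W.valuation a < 1)
    (ha : ∀ σ : L ≃ₐ[K] L, σ • W ≠ W → (σ • W).valuation a = 1) :
    letI := IsIntegralClosure.MulSemiringAction A K L B
    MulAction.stabilizer (L ≃ₐ[K] L) Q ≤ MulAction.stabilizer (L ≃ₐ[K] L) W := by
  obtain ⟨b₀, hb₀⟩ := exists_algebraMap_eq_of_coeff_mem_range A K L B hp hpa hcoeff
  exact stabilizer_le_stabilizer_of_mem A K L B W Q hQ ha ha1 b₀ hb₀

/-- **The density step of [CoP1] Prop. 9.3 ("`R₁′ ⊂ R₁ʰ` … `R₁` lies dense in `R₁′`"),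
assembled.** In the AKLB frame with `L | K` finite Galois, `A` LOCAL and centred by `W`
(`𝔪_W ∩ A = 𝔪_A`), `H ≤ Gal(L/K)` a subgroup containing the decomposition group of `W` (so
`L^H ⊆ Kˢ`), and `A` containing the coefficients of the polynomial `p` of
`exists_monic_aeval_eq_zero_coeff_mem` (Galois approximation): the natural map
`A → (B^H)_{𝔪_W ∩ B^H} / 𝔪^n` is onto for every `n`
(`surjective_quotient_maximalIdeal_pow_of_stabilizer_le`, `SplittingRingUnramified.lean`).
[cite: CossartPiltant2008, proof of Prop. 9.3 (HAL p. 28)] [cite: Abhyankar1959, Thm. 1.47] -/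
theorem surjective_quotient_maximalIdeal_pow_of_coeff_mem_range [IsGalois K L] [IsLocalRing A]
    [Q.IsPrime] [Q.LiesOver (IsLocalRing.maximalIdeal A)]
    (hQ : ∀ b : B, b ∈ Q ↔ W.valuation (algebraMap B L b) < 1) {a : L} {p : K[X]} (hp : p.Monic)
    (hpa : aeval a p = 0) (hcoeff : ∀ i, p.coeff i ∈ (algebraMap A K).range)
    (ha1 : W.valuation a < 1)
    (ha : ∀ σ : L ≃ₐ[K] L, σ • W ≠ W → (σ • W).valuation a = 1)
    (H : Subgroup (L ≃ₐ[K] L)) (hH : MulAction.stabilizer (L ≃ₐ[K] L) W ≤ H) (n : ℕ) :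
    letI := IsIntegralClosure.MulSemiringAction A K L B
    haveI : SMulCommClass (L ≃ₐ[K] L) A B :=
      ⟨fun σ x b => map_smul (galRestrict A K L B σ) x b⟩
    Function.Surjective ((Ideal.Quotient.mk (IsLocalRing.maximalIdeal
      (Localization.AtPrime (Q.under (FixedPoints.subalgebra A B H))) ^ n)).comp
        (algebraMap A (Localization.AtPrime (Q.under (FixedPoints.subalgebra A B H))))) := by
  letI := IsIntegralClosure.MulSemiringAction A K L B
  haveI : Algebra.IsInvariant A B (L ≃ₐ[K] L) := Algebra.isInvariant_of_isGalois A K L B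
  haveI : SMulCommClass (L ≃ₐ[K] L) A B :=
    ⟨fun σ x b => map_smul (galRestrict A K L B σ) x b⟩
  exact surjective_quotient_maximalIdeal_pow_of_stabilizer_le H Q
    ((stabilizer_le_stabilizer_of_coeff_mem_range A K L B W Q hQ hp hpa hcoeff ha1 ha).trans hH) n

end Models

end Literature.AlgebraicGeometry.Resolution

end
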